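import Summits.Ventures.CertifiedManyBodySolver.Downfold.RouterWord
import HarnessLib

/-!
# The set of words a box can route to only GROWS under inflation

Venture CertifiedManyBodySolver, cell `pub/hubbard-downfold` (S1 = downfolding front end = ROUTER),
seat hubbard-downfold-mod-2; namespace `Summit.Ventures.CertifiedManyBodySolver.Downfold.Router`;
a complement to `Downfold.RouterWord` §4 (`route_table_of_incl`: a table verdict on an inflation
is the verdict of the box; `route_noRow_of_incl`: `noRow` persists under inflation). Here the
CANDIDATE side: `Atom.excluded_mono` / `Row.excludedB_mono` (exclusion is monotone under box
shrinking), `Row.excludedB_eq_false_of_fires` (a firing row is live), `mem_live_of_incl` (the live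
list only grows under inflation), and the two statements `router/INFLATION-RULES.md` uses —
`route_table_mem_candidates_of_incl` (box ↦ `table w`, inflation ↦ `noRow` ⇒ `w` is a candidate
there) and `route_candidates_subset_of_incl` (candidates ⊆ candidates of any inflation); hull
corollary `route_table_mem_candidates_hull`. Consequences: the WORD-FLIP TEST of §P.11 step 7 run
on the COMPOSED (widest) box is conservative — every word any structure inside the pad could route
to is visible on the composed box — and the interval HULL of §P.12 admits every word either end
point admits. Everything is PROVED. WHAT THIS IS NOT: a statement about any material or about the
decision table of record (`ROUTER.md` §3 / `router/router.py`); only the bookkeeping every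
first-firing-row router with closed windows inherits.
-/

namespace Summit.Ventures.CertifiedManyBodySolver.Downfold

open NonemptyInterval

namespace Router

variable {ι : Type*} {K : Type*} [Field K] [LinearOrder K] [IsStrictOrderedRing K]
variable {ω : Type*}

/-- EXCLUDED is monotone under box shrinking: a window that misses the wider interval misses
every sub-interval. [folklore] -/
theorem Atom.excluded_mono {a : Atom ι} {S S' : Skel ι} (hSS' : S.Incl S')
    (h : a.excluded S' = true) : a.excluded S = true := by
  unfold Atom.excluded at h ⊢
  rcases hS' : S' a.coord with _ | I'
  · simp [hS'] at h
  · obtain ⟨I, hI, hle⟩ := hSS' a.coord I' hS'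
    simp only [hS', Bool.or_eq_true] at h
    rw [hI]
    simp only [Bool.or_eq_true]
    rcases h with h | h
    · left
      rcases hh : a.hi with _ | u
      · simp [hh] at h
      · simp only [hh, decide_eq_true_eq] at h ⊢
        exact h.trans_le hle.1
    · right
      rcases hl : a.lo with _ | l
      · simp [hl] at h
      · simp only [hl, decide_eq_true_eq] at h ⊢
        exact hle.2.trans_lt h

/-- Row exclusion is monotone under box shrinking. [folklore] -/
theorem Row.excludedB_mono {r : Row ι ω} {S S' : Skel ι} (hSS' : S.Incl S')
    (h : r.excludedB S' = true) : r.excludedB S = true := by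
  unfold Row.excludedB at h ⊢
  rw [List.any_eq_true] at h ⊢
  obtain ⟨a, ha, hx⟩ := h
  exact ⟨a, ha, Atom.excluded_mono hSS' hx⟩

/-- A window INSIDE an interval is not EXCLUDED on it (both are sound at the base point). [folklore] -/
theorem Atom.excluded_eq_false_of_inside {a : Atom ι} {S : Skel ι} (h : a.inside S = true) :
    a.excluded S = false := by
  cases hx : a.excluded S with
  | false => rfl
  | true =>
    exact absurd (Atom.inside_sound (K := ℝ) h S.basePoint_mem) (Atom.excluded_sound hx S.basePoint_mem)

/-- A firing row is live (not excluded). [folklore] -/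
theorem Row.excludedB_eq_false_of_fires {r : Row ι ω} {S : Skel ι} (h : r.fires S = true) :
    r.excludedB S = false := by
  unfold Row.fires at h
  rw [List.all_eq_true] at h
  unfold Row.excludedB
  rw [List.any_eq_false]
  intro a ha
  simp [Atom.excluded_eq_false_of_inside (h a ha)]

/-- The live list only GROWS under inflation. [folklore] -/
theorem mem_live_of_incl {T : List (Row ι ω)} {S S' : Skel ι} (hSS' : S.Incl S') {r : Row ι ω}
    (h : r ∈ live T S) : r ∈ live T S' := by
  obtain ⟨hrT, hne⟩ := List.mem_filter.1 h
  refine List.mem_filter.2 ⟨hrT, ?_⟩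
  cases hx : r.excludedB S' with
  | false => simp
  | true => simp [Row.excludedB_mono hSS' hx] at hne

/-- A `noRow` verdict's candidates are exactly the live words. [folklore] -/
theorem route_noRow_candidates {T : List (Row ι ω)} {S : Skel ι} {why : BoxReason ι}
    {cs : List ω} (h : route T S = .noRow why cs) : cs = (live T S).map (·.out) :=
  (route_noRow_sound h).2.2

/-- **INFLATION ONLY ADDS WORDS — table case.** If a box routes to `table w` and an inflation of
it routes to `noRow`, then `w` is among the inflation's candidates (the firing row stays live).
With `route_table_of_incl` (table on the inflation ⇒ the same table on the box) and
`route_candidates_subset_of_incl` below, the set of words a box can still emit only GROWS under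
inflation and only SHRINKS under refinement: the word-flip test of §P.11 step 7 on the composed
(widest) box is conservative, and the hull of two boxes (§P.12) admits every word either admits.
[folklore] -/
theorem route_table_mem_candidates_of_incl {T : List (Row ι ω)} {S S' : Skel ι}
    (hSS' : S.Incl S') {w : ω} (hS : route T S = .table w) {why' : BoxReason ι} {cs' : List ω}
    (hS' : route T S' = .noRow why' cs') : w ∈ cs' := by
  obtain ⟨r, hrT, hrw, hrf, -⟩ := route_table_sound (K := ℝ) hS
  rw [route_noRow_candidates hS']
  have hlive : r ∈ live T S :=
    List.mem_filter.2 ⟨hrT, by simp [Row.excludedB_eq_false_of_fires hrf]⟩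
  exact List.mem_map.2 ⟨r, mem_live_of_incl hSS' hlive, hrw⟩

/-- **INFLATION ONLY ADDS WORDS — `noRow` case.** The candidate list of a box is contained in the
candidate list of every inflation of it. [folklore] -/
theorem route_candidates_subset_of_incl {T : List (Row ι ω)} {S S' : Skel ι} (hSS' : S.Incl S')
    {why why' : BoxReason ι} {cs cs' : List ω} (hS : route T S = .noRow why cs)
    (hS' : route T S' = .noRow why' cs') : ∀ w ∈ cs, w ∈ cs' := by
  intro w hw
  rw [route_noRow_candidates hS] at hw
  rw [route_noRow_candidates hS']
  obtain ⟨r, hr, rfl⟩ := List.mem_map.1 hw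
  exact List.mem_map.2 ⟨r, mem_live_of_incl hSS' hr, rfl⟩

/-- Hull corollary (§P.12): a table word of either end box is the hull's table word or among the
hull's candidates. [folklore] -/
theorem route_table_mem_candidates_hull {T : List (Row ι ω)} (S₁ S₂ : Skel ι) {w : ω}
    (h : route T S₁ = .table w ∨ route T S₂ = .table w) {why : BoxReason ι} {cs : List ω}
    (hh : route T (S₁.hull S₂) = .noRow why cs) : w ∈ cs := by
  rcases h with h | h
  · exact route_table_mem_candidates_of_incl (Skel.incl_hull_left S₁ S₂) h hh
  · exact route_table_mem_candidates_of_incl (Skel.incl_hull_right S₁ S₂) h hh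

end Router

end Summit.Ventures.CertifiedManyBodySolver.Downfold
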